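import Mathlib
import HarnessLib
import Summits.ValiantsHypothesis.ValiantsHypothesis.Theses.MonotoneRestoration
import Literature.Computability.AlgebraicComplexity.ArithCircuit
import Literature.Computability.AlgebraicComplexity.ArithCircuitProofs
import Literature.Computability.AlgebraicComplexity.MonotoneStructure
import Literature.Computability.AlgebraicComplexity.PermanentIrreducible
import Literature.ModelTheory.FiniteModelTheory.CkEquiv
import Summits.ValiantsHypothesis.ValiantsHypothesis.Theorems.MonotoneRestorationMonotoneRestorationQPCosetCount
import Summits.ValiantsHypothesis.ValiantsHypothesis.Theorems.MonotoneRestorationMonotoneRestorationQPSymmetricLB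
import Summits.ValiantsHypothesis.ValiantsHypothesis.Theorems.MonotoneRestorationMonotoneRestorationQPSupportSymmetrisation
import Summits.ValiantsHypothesis.ValiantsHypothesis.Theorems.MonotoneRestorationMonotoneRestorationQPSparseRegime
import Summits.ValiantsHypothesis.ValiantsHypothesis.Theorems.MonotoneRestorationMonotoneRestorationQPBeta
import Literature.Computability.AlgebraicComplexity.SymmetricArithCircuit
import Literature.Computability.AlgebraicComplexity.DawarWilsenach2025Proofs
import Literature.GroupTheory.PermutationGroups.SmallIndexSubgroups
import Summits.ValiantsHypothesis.ValiantsHypothesis.Theorems.MonotoneRestorationQP.Negative.LoadBearing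
import Summits.ValiantsHypothesis.ValiantsHypothesis.Theorems.MonotoneRestorationMonotoneRestorationQPPermSupportCount

/-! TTRL-lite variant V19016 of stmt-ValiantsHypothesis-15886

Variant V19016 (`lemma_proposal`) of the stub `stub_monotoneComputation_of_complexity` of the crux
`MonotoneRestorationQP`: the gate-level semantic identity behind the factor `3` in the
Jerrum–Snir plainification `P.size ≤ 3 · complexity f` — a weighted binary sum gate
`c • x + d • y` has the same value as the plain sum of the two product gates `const c ⊗ x` and
`const d ⊗ y` (`MvPolynomial.smul_eq_C_mul`).
-/

-- `ValiantsHypothesis.ValiantsHypothesis`: the D-0017 layout repeats the problem name in the path.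
set_option linter.dupNamespace false

namespace Summit.ValiantsHypothesis.ValiantsHypothesis.Theorems

open Summit.ValiantsHypothesis.ValiantsHypothesis.Theses.MonotoneRestoration
open Literature.Computability.AlgebraicComplexity

/-- **TTRL-lite variant V19016** (gate-level identity) of `stub_monotoneComputation_of_complexity`
(stmt-ValiantsHypothesis-15886): against any list `w` of earlier gate values, the weighted binary
sum gate `sum [(c, x), (d, y)]` evaluates to the sum of the values of the two product gates
`prod [const c, x]` and `prod [const d, y]`, since `c • p = C c * p` in `MvPolynomial σ ℝ≥0`
(`MvPolynomial.smul_eq_C_mul`). This is the semantic content of expanding one weighted sum gate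
into three plain gates. [cite: JerrumSnir1982, §2.2] -/
theorem stub_monotoneComputation_of_complexity_var19016 :
    ∀ (σ : Type) (w : List (MvPolynomial σ NNReal)) (c d : NNReal)
      (x y : ArithCircuit.Operand NNReal σ),
      (ArithCircuit.Gate.sum [(c, x), (d, y)] : ArithCircuit.Gate NNReal σ).eval w =
        (ArithCircuit.Gate.prod [ArithCircuit.Operand.const c, x] :
            ArithCircuit.Gate NNReal σ).eval w +
          (ArithCircuit.Gate.prod [ArithCircuit.Operand.const d, y] :
            ArithCircuit.Gate NNReal σ).eval w := by
  intro σ w c d x y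
  simp only [ArithCircuit.Gate.eval, ArithCircuit.Operand.eval, List.map_cons, List.map_nil,
    List.sum_cons, List.sum_nil, List.prod_cons, List.prod_nil, add_zero, mul_one,
    MvPolynomial.smul_eq_C_mul]

end Summit.ValiantsHypothesis.ValiantsHypothesis.Theorems
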